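import Literature.IUT.LogThetaLattice.GlobalFrobenioidModels
import Mathlib.Algebra.Field.Subfield.Basic
import Mathlib.Algebra.Ring.Subring.Units
import HarnessLib

/-!
# [IUTchIII] Remark 3.6.2 (i) (b): a subgroup `Γ ⊆ F^×` with `Γ ∪ {0}` an additive subgroup IS the
# multiplicative group of a subfield — the faithful (module) reading, PROVED (proof-only companion)

S. Mochizuki, *Inter-universal Teichmüller Theory III*, kurims manuscript (May 2020), Remark 3.6.2 (i),
p. 109 l. 5–20 [claim: Mochizuki2012, status: disputed]: "the rational function monoid `F^×_mod` of
`𝓕⊛_mod` satisfies the following fundamental property: [the union with `{0}` of] `F^×_mod` admits a natural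
additive structure. … this property is not satisfied by … (b) subgroups `Γ ⊆ F^×_mod` — such as, for
instance, the trivial subgroup `{1}` or the subgroup of `S`-units, for `S ⊆ 𝕍_mod` a nonempty finite
subset — that do not arise as the multiplicative group of some subfield of `F_mod`"; and (l. 21–23) "The
significance of this fundamental property is that it allows one to represent the objects of `𝓕⊛_mod`
additively, i.e., as modules".

PROOF-ONLY companion (abc-iut cell, wave-5 seat abc-iut-w5-d008; no definition, no new `Prop` fact) of
abc-iut-L6-t4's `GlobalFrobenioidModels.lean`, written during the RQ7 second pass of abc-iut-w4-d011's
negative witness `GlobalFrobenioidModelsNegative362i.lean` (the unprimed schema `Remark362i_Sunits` —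
"proper subgroup ⇒ not ADDITIVELY CLOSED" — fails at the positive rationals `ℚ_{>0} ⊊ ℚ^×`, whose union
with `0` is closed under `+`). READING RECORDED HERE: print's "admits a natural additive structure" asks
for a MODULE structure ("i.e., as modules", l. 23), i.e. `Γ ∪ {0}` closed under `+` AND `−`, not merely
under `+` (the typer's `IsAdditivelyClosed`); under that reading clause (b) needs no extra hypothesis and
holds for EVERY subgroup: if `Γ ∪ {0}` is closed under subtraction then `Γ ∪ {0}` is (the carrier of) a
subfield of `F` whose multiplicative group is `Γ` (`exists_subfield_of_sub_mem`), so a subgroup "that does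
not arise as the multiplicative group of some subfield" never has the fundamental property
(`not_sub_closed_of_not_subfield`); the printed instances follow: `{1}` in characteristic `0`
(`not_sub_closed_bot`) and any subgroup missing some positive integer, e.g. `S`-units for `S ≠ ∅`
(`not_sub_closed_of_natCast_not_mem`). The positive rationals are closed under `+` but not under `−`,
which is exactly why they refute the weaker typing and not the printed sentence. Elementary algebra;
nothing here bears on [IUTchIII] Cor. 3.12 or takes a side; typed ≠ proved elsewhere.
-/

namespace Literature.IUT.LogThetaLattice

namespace GlobalFrobenioidModels

universe u

variable {F : Type u} [Field F]

/-- The subset `Γ ∪ {0} ⊆ F` attached to a subgroup `Γ ⊆ F^×` (the typer's `{x | ∃ u ∈ Γ, ↑u = x}`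
of `Remark362i_Sunits`, union `{0}`). **IUTchIII:Rmk3.6.2(i)** (kurims p.109 l.5–8) membership
unfolds to "`= 0` or a unit of `Γ`" — PROVED. [claim: Mochizuki2012, status: disputed] -/
theorem mem_unitsSet_union_zero_iff (Γ : Subgroup Fˣ) (a : F) :
    a ∈ {x : F | ∃ u ∈ Γ, (u : F) = x} ∪ {0} ↔ a = 0 ∨ ∃ u ∈ Γ, (u : F) = a := by
  simp only [Set.union_singleton, Set.mem_insert_iff, Set.mem_setOf_eq]

/-- **IUTchIII:Rmk3.6.2(i)** (kurims p.109 l.5–20), the faithful ("as modules", l.23) reading of clause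
(b), PROVED for an arbitrary field `F` and an arbitrary subgroup `Γ ⊆ F^×`: if `Γ ∪ {0}` is closed under
SUBTRACTION (equivalently: is an additive subgroup of `F`, since `0 ∈ Γ ∪ {0}`), then `Γ ∪ {0}` is the
underlying set of a subfield of `F` — i.e. `Γ` "arise[s] as the multiplicative group of some subfield".
[claim: Mochizuki2012, status: disputed] -/
theorem exists_subfield_of_sub_mem (Γ : Subgroup Fˣ)
    (h : ∀ a ∈ {x : F | ∃ u ∈ Γ, (u : F) = x} ∪ {0}, ∀ b ∈ {x : F | ∃ u ∈ Γ, (u : F) = x} ∪ {0},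
      a - b ∈ {x : F | ∃ u ∈ Γ, (u : F) = x} ∪ {0}) :
    ∃ k : Subfield F, (k : Set F) = {x : F | ∃ u ∈ Γ, (u : F) = x} ∪ {0} := by
  set S : Set F := {x : F | ∃ u ∈ Γ, (u : F) = x} ∪ {0} with hS
  have h0 : (0 : F) ∈ S := Or.inr rfl
  have h1 : (1 : F) ∈ S := Or.inl ⟨1, Γ.one_mem, rfl⟩
  have hneg : ∀ a ∈ S, -a ∈ S := fun a ha => by simpa using h 0 h0 a ha
  have hadd : ∀ a ∈ S, ∀ b ∈ S, a + b ∈ S := fun a ha b hb => by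
    simpa using h a ha (-b) (hneg b hb)
  have hmul : ∀ a ∈ S, ∀ b ∈ S, a * b ∈ S := by
    rintro a (⟨u, hu, rfl⟩ | ha) b (⟨v, hv, rfl⟩ | hb)
    · exact Or.inl ⟨u * v, Γ.mul_mem hu hv, by simp⟩
    · rw [Set.mem_singleton_iff] at hb; subst hb; simpa using h0
    · rw [Set.mem_singleton_iff] at ha; subst ha; simpa using h0
    · rw [Set.mem_singleton_iff] at ha; subst ha; simpa using h0
  have hinv : ∀ a ∈ S, a⁻¹ ∈ S := by
    rintro a (⟨u, hu, rfl⟩ | ha)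
    · exact Or.inl ⟨u⁻¹, Γ.inv_mem hu, by simp⟩
    · rw [Set.mem_singleton_iff] at ha; subst ha; simpa using h0
  refine ⟨{ carrier := S, mul_mem' := fun {a b} ha hb => hmul a ha b hb, one_mem' := h1,
            add_mem' := fun {a b} ha hb => hadd a ha b hb, zero_mem' := h0,
            neg_mem' := fun {a} ha => hneg a ha, inv_mem' := fun a ha => hinv a ha }, rfl⟩

/-- **IUTchIII:Rmk3.6.2(i)** (kurims p.109 l.9–13) clause (b) as printed, contrapositive form, PROVED:
a subgroup `Γ ⊆ F^×` "that do[es] not arise as the multiplicative group of some subfield" — here: whose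
`Γ ∪ {0}` is not the underlying set of any subfield — does NOT have the fundamental property in the
module reading (`Γ ∪ {0}` is not closed under subtraction). [claim: Mochizuki2012, status: disputed] -/
theorem not_sub_closed_of_not_subfield (Γ : Subgroup Fˣ)
    (hΓ : ¬ ∃ k : Subfield F, (k : Set F) = {x : F | ∃ u ∈ Γ, (u : F) = x} ∪ {0}) :
    ¬ ∀ a ∈ {x : F | ∃ u ∈ Γ, (u : F) = x} ∪ {0}, ∀ b ∈ {x : F | ∃ u ∈ Γ, (u : F) = x} ∪ {0},
      a - b ∈ {x : F | ∃ u ∈ Γ, (u : F) = x} ∪ {0} :=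
  fun h => hΓ (exists_subfield_of_sub_mem Γ h)

/-- Converse direction (trivial): the multiplicative group of a subfield HAS the fundamental property —
if `Γ ∪ {0}` is the underlying set of a subfield then it is closed under subtraction. PROVED; together
with `exists_subfield_of_sub_mem` this makes **IUTchIII:Rmk3.6.2(i)** (b) (kurims p.109) an `iff`.
[claim: Mochizuki2012, status: disputed] -/
theorem sub_mem_of_exists_subfield (Γ : Subgroup Fˣ)
    (hk : ∃ k : Subfield F, (k : Set F) = {x : F | ∃ u ∈ Γ, (u : F) = x} ∪ {0}) :
    ∀ a ∈ {x : F | ∃ u ∈ Γ, (u : F) = x} ∪ {0}, ∀ b ∈ {x : F | ∃ u ∈ Γ, (u : F) = x} ∪ {0},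
      a - b ∈ {x : F | ∃ u ∈ Γ, (u : F) = x} ∪ {0} := by
  obtain ⟨k, hk⟩ := hk
  intro a ha b hb
  rw [← hk] at ha hb ⊢
  exact k.sub_mem ha hb

/-- **IUTchIII:Rmk3.6.2(i)** (kurims p.109 l.10–11) printed instance "the subgroup of `S`-units, for `S`
a nonempty finite subset" in the abstract form every `S`-unit group of a number field satisfies (some
positive integer `n` — any `n` divisible by a prime under `S` — is not an `S`-unit; cf. the hypothesis
of abc-iut-L6-t4's repaired `Remark362i_Sunits'`): a subgroup `Γ` missing some natural number `n ≠ 0`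
(as an element of `F`) does not have the fundamental property in the module reading, since a subfield
contains every `n · 1`. PROVED. [claim: Mochizuki2012, status: disputed] -/
theorem not_sub_closed_of_natCast_not_mem (Γ : Subgroup Fˣ) (n : ℕ) (hn : (n : F) ≠ 0)
    (hΓ : ∀ u ∈ Γ, (u : F) ≠ n) :
    ¬ ∀ a ∈ {x : F | ∃ u ∈ Γ, (u : F) = x} ∪ {0}, ∀ b ∈ {x : F | ∃ u ∈ Γ, (u : F) = x} ∪ {0},
      a - b ∈ {x : F | ∃ u ∈ Γ, (u : F) = x} ∪ {0} := by
  refine not_sub_closed_of_not_subfield Γ ?_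
  rintro ⟨k, hk⟩
  have hmem : (n : F) ∈ (k : Set F) := natCast_mem k n
  rw [hk, mem_unitsSet_union_zero_iff] at hmem
  rcases hmem with h0 | ⟨u, hu, hun⟩
  · exact hn h0
  · exact hΓ u hu hun

/-- **IUTchIII:Rmk3.6.2(i)** (kurims p.109 l.10) printed instance "the trivial subgroup `{1}`", in
characteristic zero (number fields): `{0, 1}` is not closed under subtraction (`2 ∉ {0,1}` would be
forced). PROVED. [claim: Mochizuki2012, status: disputed] -/
theorem not_sub_closed_bot [CharZero F] :
    ¬ ∀ a ∈ {x : F | ∃ u ∈ (⊥ : Subgroup Fˣ), (u : F) = x} ∪ {0},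
      ∀ b ∈ {x : F | ∃ u ∈ (⊥ : Subgroup Fˣ), (u : F) = x} ∪ {0},
        a - b ∈ {x : F | ∃ u ∈ (⊥ : Subgroup Fˣ), (u : F) = x} ∪ {0} := by
  refine not_sub_closed_of_natCast_not_mem ⊥ 2 (by exact_mod_cast (two_ne_zero : (2 : F) ≠ 0)) ?_
  intro u hu
  rw [Subgroup.mem_bot] at hu
  subst hu
  norm_num

/-- Why the weaker typing `IsAdditivelyClosed` (closure under `+` only) is refutable while the printed
sentence is not: **IUTchIII:Rmk3.6.2(i)** (kurims p.109) in the module reading is about closure under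
`+` AND `−`; the positive rationals `ℚ_{>0} ⊊ ℚ^×` (abc-iut-w4-d011's witness
`not_Remark362i_Sunits_posSubgroup`) are closed under `+` but NOT under `−`: `0 − 1 ∉ ℚ_{≥0}`. PROVED.
[claim: Mochizuki2012, status: disputed] -/
theorem posSubgroup_rat_not_sub_closed :
    ¬ ∀ a ∈ {x : ℚ | ∃ u ∈ Units.posSubgroup ℚ, (u : ℚ) = x} ∪ {0},
      ∀ b ∈ {x : ℚ | ∃ u ∈ Units.posSubgroup ℚ, (u : ℚ) = x} ∪ {0},
        a - b ∈ {x : ℚ | ∃ u ∈ Units.posSubgroup ℚ, (u : ℚ) = x} ∪ {0} := by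
  intro h
  have h1 : (1 : ℚ) ∈ {x : ℚ | ∃ u ∈ Units.posSubgroup ℚ, (u : ℚ) = x} ∪ {0} :=
    Or.inl ⟨1, by simp, rfl⟩
  have hm := h 0 (Or.inr rfl) 1 h1
  rw [mem_unitsSet_union_zero_iff] at hm
  rcases hm with hm | ⟨u, hu, hu'⟩
  · norm_num at hm
  · rw [Units.mem_posSubgroup] at hu
    have : (u : ℚ) = -1 := by rw [hu']; norm_num
    rw [this] at hu
    norm_num at hu

end GlobalFrobenioidModels

end Literature.IUT.LogThetaLattice
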